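import Summits.BirchSwinnertonDyer.BirchSwinnertonDyer.Theorems.PrintCf2RamifiedOffTYZSelmerRankOneSevenOfFacts
import Summits.BirchSwinnertonDyer.Rank1Residual.P2.CongruentNumberGenusDoorsNoGZK
import Literature.NumberTheory.EllipticCurves.Smith2016.CongruentNumberGenusDeterminantRowSevenA
import Literature.NumberTheory.EllipticCurves.Smith2016.CongruentNumberRedeiCofactor
import Literature.NumberTheory.EllipticCurves.TianYuanZhang2017.CMPointRingClassDisplaysProofs
import HarnessLib

/-!
# Crux `PrintCf2.RamifiedOffTYZOfFacts` (stmt-BirchSwinnertonDyer-20509), line `offtyz-v7`, LEAD cycle 9 (cruxlead-20509 g8):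
# THE WHOLE `s = 1` STRATUM FOR `n ≡ 7 (mod 8)` — the degenerate sector «all prime factors ≡ ±1 (mod 8)» has `Σ₁(n)` ODD, so TYZ's own
# genus door takes it; with the mover sector («some prime factor ≡ ±3 (mod 8)», `…SelmerRankOneSevenOfFacts`): EVERY square-free
# `n ≡ 7 (mod 8)` with `#Sel₂(E_n) = 8` has `ord = rank = 1`, `Ш[2^∞] = 0`, `BSD(E_n, 2)`, modulo the two printed facts

THEOREMS ONLY (no `def`, no named fact, no `sorry`), `--supports stmt-BirchSwinnertonDyer-20509` (item 23432's `s = 1`, `n ≡ 7 (8)` stratum,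
now COMPLETE modulo `tyz_cmPointRingClassFrobeniusData ∧ thm11_parity_of_scriptL`, exactly as g7's `n ≡ 5 (8)` theorem p694796).

* §1 `det_sevenA_eq_adjugate_of_legendreSym_two_eq_zero` — **Smith's `M_{7a}` collapses when every `(2/pᵢ) = +1`**: for `n = p₁⋯p_k ≡ 3 (mod 4)`
  with `z = ((2/pᵢ)₊) = 0`, `det M_{7a} = adj(A)_{cc}` (any `c`): in the pointed forest expansion of `det M_{7a}` (`det_sevenA_eq_sum_powerset`,
  Smith's (eq:7a_develop)) every term carries a factor `q_z`, `Σ_B z` or `setExp(fwt a z z z)` of a nonempty set, all `0` at `z = 0`, except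
  `(Σ_{[k]} t) · q_t(A) = κ_c(A) = adj(A)_{cc}` (odd block is flat).  Hence `Σ₁(n) ≡ g(n) ≡ adj(A)_{cc}` (Smith row 7(a) + Table 1).
* §2 `adjugate_legendreMatrix_eq_one_of_selmerEight` — for such `n` with `#Sel₂(E_n) = 8`: `adj(A)_{cc} = 1` (`ker M_n ⊇ ker A ⊕ 0`, so
  `#ker A ≤ 2`; rows and columns of `A` sum to `0`; `…RedeiCofactor.two_lt_card_ker_of_adjugate_ne_one`).  So `Σ₁(n)` is ODD
  (`odd_genusSum₁_of_selmerEight_of_legendreSym_two_eq_zero`) — the LEAD's census conjecture «all pᵢ ≡ ±1 (8) ∧ s(n) = 1 ⟹ Σ₁ odd», now a theorem.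
* §3 `rankOne_sha_bsdp_two_of_selmerEight_of_tyz_seven_pm_one` — through the tree's GZK-free genus door
  (`P2.rankOne_sha_bsdp_two_congruentNumberCurve_of_selmerEight_noGZK`, modulo `tyz_genusPointData` ALONE): square-free `n ≡ 7 (mod 8)`, all prime
  factors `≡ ±1 (mod 8)`, `#Sel₂(E_n) = 8` ⟹ `ord = rank = 1`, `Ш[2^∞] = 0`, `BSD(E_n, 2)`.
* §4 **`rankOne_sha_bsdp_two_of_selmerEight_of_facts_seven_all`** — the UNION: `(hF : tyz_cmPointRingClassFrobeniusData) (h11 : thm11_parity_of_scriptL)`,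
  square-free `n ≡ 7 (mod 8)`, `#Sel₂(E_n) = 8` ⟹ the four conclusions (a prime factor `≡ ±3 (8)`: the Galois mover, `…SevenOfFacts`; none: §3 with
  `tyz_genusPointData ⟸ tyz_cmPointRingClassData ⟸ hF`); `…_of_facts_odd_all` — with g7's `n ≡ 5` theorem: **every square-free odd `n ≡ 5, 7 (mod 8)`
  with `#Sel⁽²⁾(E_n/ℚ) = 8`**; `OfFacts` shape and isogeny saturation (𝔅_ram 1–3).
BSD is not proved by any of this; no class is closed by this file (conditional results toward item 23432).

References: [cite: Smith2016CongruentDensity, Thm. 2.2 row 7(a), §2 Table 1, §2.2 (eq:7a_develop)]; [cite: TianYuanZhang2017, Thm. 1.1, Thm. 1.2, Thm. 3.5, §3];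
[cite: HeathBrown1994SelmerCongruentII, Appendix (Monsky), typescript p. 39 L10–L41]; [cite: LiMa2008, Thm. 0.4]; [cite: MilneADT2006, Thm. I.7.3]; [cite: Miller2011LMS, Def. 1.1].
-/

noncomputable section

open scoped Classical

open WeierstrassCurve Matrix Finset Literature.NumberTheory.EllipticCurves Literature.NumberTheory.EllipticCurves.TianYuanZhang2017
  Literature.NumberTheory.EllipticCurves.TianYuanZhang2017.W2
  Literature.NumberTheory.EllipticCurves.HeathBrown1994
  Literature.NumberTheory.EllipticCurves.MonskySelmerParity
  Literature.NumberTheory.EllipticCurves.Smith2016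
  Literature.NumberTheory.EllipticCurves.Rank1Residual
  Literature.NumberTheory.QuadraticFields.RingClass
  Literature.LinearAlgebra.Matrix Literature.Combinatorics.Enumerative
  Summit.BirchSwinnertonDyer.PrintCf2.QForm Summit.BirchSwinnertonDyer.PrintCf2.QFormForest

set_option autoImplicit false

namespace Summit.BirchSwinnertonDyer.PrintCf2.MoverAssembly

/-! ## §1 Smith's `M_{7a}` at `z = 0` -/

section SevenA

variable {k : ℕ} (p : Fin k → ℕ) (hp : ∀ i, (p i).Prime) (hodd : ∀ i, Odd (p i)) (hinj : Function.Injective p)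

/-- `setExp 0 S = [S = ∅]`. [cite: Stanley1999EC2, Cor. 5.1.6 (exponential formula; elementary finite form)] -/
theorem setExp_zero_eq_ite {α : Type*} [LinearOrder α] (S : Finset α) :
    setExp (0 : Finset α → ZMod 2) S = if S = ∅ then 1 else 0 := by
  by_cases h : S = ∅
  · rw [if_pos h, h, setExp_empty]
  · rw [if_neg h, setExp_zero_of_nonempty (nonempty_iff_ne_empty.mpr h)]

/-- Monsky's `A` IS the Laplacian-type block of its own (untransposed) off-diagonal weights with zero root weights.
[cite: HeathBrown1994SelmerCongruentII, Appendix (Monsky), typescript p. 39 L13–L26] [cite: Chaiken1982, §2] -/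
theorem lap_legendreMatrix_univ_zero : lap (fun i j => legendreMatrix p i j) univ 0 = legendreMatrix p := by
  ext i j
  rw [lap_apply]
  simp only [mem_univ, and_self, if_true, Pi.zero_apply, zero_add]
  by_cases hij : i = j
  · subst hij
    rw [if_pos rfl, Families.legendreMatrix_apply_self]
  · rw [if_neg hij]

include hp hodd hinj in
/-- **`det M_{7a} = adj(A)_{cc}` when every `(2/pᵢ) = +1`** (`n = p₁⋯p_k ≡ 3 (mod 4)`, `z = 0`): Smith's pointed forest expansion of `det M_{7a}`
(`det_sevenA_eq_sum_powerset`) with all `z`-weights zero leaves `(Σ t)·q_t(A^{[k]}) = κ_c(A)` (odd block flat) `= adj(A)_{cc}`.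
[cite: Smith2016CongruentDensity, §2.2 (eq:7a_develop) and Thm. 2.2 row 7(a)] [cite: Chaiken1982, §2] -/
theorem det_sevenA_eq_adjugate_of_legendreSym_two_eq_zero (h4 : (∏ i, p i) % 4 = 3) (hz : ∀ i, addLegendreSym 2 (p i) = 0) (c : Fin k) :
    (fromBlocks (fromBlocks (fromBlocks (legendreMatrix p + (legendreMatrix p)ᵀ) (legendreMatrix p)ᵀ (legendreMatrix p)
          (legendreDiagonal p 2))
        (replicateCol Unit (Sum.elim (fun i => addLegendreSym (-1) (p i) + addLegendreSym 2 (p i)) (0 : Fin k → ZMod 2)))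
        (replicateRow Unit (Sum.elim (fun i => addLegendreSym (-1) (p i) + addLegendreSym 2 (p i)) (0 : Fin k → ZMod 2))) 0)
      (replicateCol Unit (Sum.elim (Sum.elim (0 : Fin k → ZMod 2) (fun i => addLegendreSym (-1) (p i))) 0))
      (replicateRow Unit (Sum.elim (Sum.elim (0 : Fin k → ZMod 2) (fun i => addLegendreSym (-1) (p i))) 0)) 0).det =
      (legendreMatrix p).adjugate c c := by
  have hp2 : ∀ i, p i ≠ 2 := ne_two_of_odd p hodd
  have hzf : (fun i => addLegendreSym 2 (p i)) = (0 : Fin k → ZMod 2) := funext hz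
  have hk : 0 < k := pos_of_prod_mod_four_eq_three p h4
  have hy : ∑ i, addLegendreSym (-1) (p i) = 1 := by
    rw [sum_addLegendreSym_neg_one_eq p hp hp2, if_neg (by omega)]
  rw [det_sevenA_eq_sum_powerset, hzf]
  set a : Fin k → Fin k → ZMod 2 := fun i j => legendreMatrix p i j with ha
  have hq0 : ∀ B : Finset (Fin k), qwt a 0 B = 0 := qwt_zero_weight a
  have hfwt0 : fwt a (0 : Fin k → ZMod 2) 0 0 = 0 := by
    funext B; rw [fwt, hq0, mul_zero, zero_add, Pi.zero_apply]
  simp only [hq0, mul_zero, zero_mul, sum_const_zero, zero_add, add_zero, Pi.zero_apply, hfwt0, setExp_zero_eq_ite,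
    sdiff_eq_empty_iff_subset]
  -- only `B = univ` survives
  rw [sum_eq_single_of_mem (univ : Finset (Fin k)) (mem_powerset.mpr subset_rfl)]
  · rw [if_pos subset_rfl, mul_one]
    simp only [hz, add_zero]
    rw [hy, one_mul,
      qwt_eq_sum_mul_treeDet_of_odd a (fun i => addLegendreSym (-1) (p i)) (fun i => addLegendreSym (-1) (p i))
        (hrec_legendre p hp hp2 hinj) hy (mem_univ c), hy, one_mul, ← adjugate_lap_univ_zero_self, ha, lap_legendreMatrix_univ_zero]
  · intro B hB hBne
    rw [mem_powerset] at hB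
    rw [if_neg (fun h => hBne (subset_antisymm hB h)), mul_zero]

end SevenA

/-! ## §2 `#Sel₂ = 8` with all `(2/pᵢ) = +1` forces `adj(A)_{cc} = 1`, hence `Σ₁(n)` odd -/

section KerA

variable {k : ℕ} (p : Fin k → ℕ) (hp : ∀ i, (p i).Prime) (hodd : ∀ i, Odd (p i)) (hinj : Function.Injective p)

include hp hodd hinj in
/-- **`#Sel₂(E_n) = 8` and every `(2/pᵢ) = +1` ⟹ `adj(A)_{cc} = 1`** (`n ≡ 3 (mod 4)`): `D₂ = 0`, so `v ↦ (v; 0)` embeds `ker A` into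
`ker M_n` (`#ker M_n = 2`), `#ker Aᵀ = #ker A ≤ 2`, and for a matrix whose rows and columns sum to zero `adj_{cc} ≠ 1` would give `#ker > 2`.
[cite: HeathBrown1994SelmerCongruentII, Appendix (Monsky), typescript p. 39 L27–L41] [cite: Smith2016CongruentDensity, §2 Table 1] -/
theorem adjugate_legendreMatrix_eq_one_of_selmerEight (h4 : (∏ i, p i) % 4 = 3) (hz : ∀ i, addLegendreSym 2 (p i) = 0)
    (hsel : Nat.card ((congruentNumberCurve (∏ i, p i)).selmerGroup 2) = 8) (c : Fin k) :
    (legendreMatrix p).adjugate c c = 1 := by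
  have hk : 0 < k := pos_of_prod_mod_four_eq_three p h4
  have hkerM := card_ker_monsky_eq_two_of_card_selmer_eight p hp hodd hinj hsel
  have hD2 : legendreDiagonal p 2 = 0 := by
    rw [legendreDiagonal]
    ext i j
    rw [diagonal_apply, Matrix.zero_apply, hz]; split_ifs <;> rfl
  -- `ker A ↪ ker M_n`
  have hle : Fintype.card {v : Fin k → ZMod 2 // legendreMatrix p *ᵥ v = 0} ≤ 2 := by
    refine le_of_le_of_eq ?_ hkerM
    refine Fintype.card_le_of_injective (fun v => ⟨Sum.elim v.1 0, ?_⟩) ?_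
    · have hv := v.2
      ext x
      rw [monskyMatrixOdd, fromBlocks_mulVec, Sum.elim_comp_inl, Sum.elim_comp_inr, hD2]
      rcases x with i | i
      · rw [Sum.elim_inl, Pi.zero_apply, add_zero, mulVec_zero, add_zero, hv, Pi.zero_apply]
      · rw [Sum.elim_inr, Pi.zero_apply, zero_mulVec, mulVec_zero, zero_add, Pi.zero_apply]
    · intro v w h
      have h' := congrArg (fun x : {u : Fin k ⊕ Fin k → ZMod 2 // monskyMatrixOdd p *ᵥ u = 0} => x.1 ∘ Sum.inl) h
      exact Subtype.ext (by simpa using h')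
  -- `#ker Aᵀ = #ker A`
  have hT : Fintype.card {v : Fin k → ZMod 2 // (legendreMatrix p)ᵀ *ᵥ v = 0} ≤ 2 := by
    rw [card_ker_mulVec_eq_pow, rank_transpose, ← card_ker_mulVec_eq_pow]; exact hle
  by_contra hadj
  have hlt := two_lt_card_ker_of_adjugate_ne_one (legendreMatrix p) _ rfl hk (legendreMatrix_mulVec_one p)
    (one_vecMul_legendreMatrix_of_three_mod_four p hp hodd hinj h4) hadj
  omega

include hp hodd hinj in
/-- **`Σ₁(n)` IS ODD for `n = p₁⋯p_k ≡ 7 (mod 8)` with every `pᵢ ≡ ±1 (mod 8)` and `#Sel₂(E_n) = 8`** (Smith row 7(a) + §1 + §2) — the degenerate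
sector of the mover theory (`κ_n = (𝟙; 0)`, no square mover) satisfies Tian–Yuan–Zhang's own genus criterion. New as stated: TYZ Thm 1.1's `n ≡ 7`
family is the case of ONE prime `≡ 7 (mod 8)`. [cite: Smith2016CongruentDensity, Thm. 2.2 row 7(a)] [cite: TianYuanZhang2017, Thm. 1.1, Thm. 1.2]
[cite: HeathBrown1994SelmerCongruentII, Appendix (Monsky), typescript p. 39 L10–L41] -/
theorem odd_genusSum₁_of_selmerEight_of_legendreSym_two_eq_zero (h7 : (∏ i, p i) % 8 = 7) (hz : ∀ i, addLegendreSym 2 (p i) = 0)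
    (hsel : Nat.card ((congruentNumberCurve (∏ i, p i)).selmerGroup 2) = 8) :
    Odd (genusSum₁ (∏ i, p i) fun d => genusClassNumber (GenusField d)) := by
  have hk : 0 < k := pos_of_prod_mod_four_eq_three p (by omega)
  obtain ⟨c⟩ : Nonempty (Fin k) := ⟨⟨0, hk⟩⟩
  rw [odd_iff_natCast_zmod_two_eq_one, genusSum₁_eq_det_sevenA p hp hodd hinj h7,
    det_sevenA_eq_adjugate_of_legendreSym_two_eq_zero p hp hodd hinj (by omega) hz c]
  exact adjugate_legendreMatrix_eq_one_of_selmerEight p hp hodd hinj (by omega) hz hsel c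

end KerA

/-! ## §3 The degenerate sector through TYZ's GZK-free genus door -/

/-- `p ≡ 1, 7 (mod 8)` iff `(2/p)₊ = 0` for an odd prime. [cite: HeathBrown1994SelmerCongruentII, Appendix (Monsky), typescript p. 39 L10–L13] -/
theorem addLegendreSym_two_eq_zero_of_mod_eight {q : ℕ} (hq : Odd q) (h : q % 8 = 1 ∨ q % 8 = 7) : addLegendreSym 2 q = 0 := by
  rw [addLegendreSym_two_of_odd hq, if_pos h]

/-- **The degenerate sector, modulo `tyz_genusPointData` alone**: square-free `n ≡ 7 (mod 8)` all of whose prime factors are `≡ ±1 (mod 8)`,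
`#Sel⁽²⁾(E_n/ℚ) = 8` ⟹ `ord_{s=1} L(E_n,s) = 1`, `rank E_n(ℚ) = 1`, `Ш(E_n)[2^∞] = 0`, `BSD(E_n, 2)` (`Σ₁(n)` odd by §2, then the tree's genus door
`P2.rankOne_sha_bsdp_two_congruentNumberCurve_of_selmerEight_noGZK`). [cite: TianYuanZhang2017, Thm. 1.2, Thm. 3.5 and its proof]
[cite: Smith2016CongruentDensity, Thm. 2.2 row 7(a)] [cite: Miller2011LMS, Def. 1.1] -/
theorem rankOne_sha_bsdp_two_of_selmerEight_of_tyz_seven_pm_one (hTYZ : tyz_genusPointData)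
    {n : ℕ} (hsq : Squarefree n) (h7 : n % 8 = 7) (hpm : ∀ q : ℕ, q.Prime → q ∣ n → q % 8 = 1 ∨ q % 8 = 7)
    (hsel : haveI := isElliptic_congruentNumberCurve hsq.ne_zero; Nat.card ((congruentNumberCurve n).selmerGroup 2) = 8) :
    haveI := isElliptic_congruentNumberCurve hsq.ne_zero
    (congruentNumberCurve n).analyticRank = 1 ∧ (congruentNumberCurve n).mordellWeilRank = 1 ∧
      AddCommGroup.primaryComponent (congruentNumberCurve n).sha 2 = ⊥ ∧ BSDp (congruentNumberCurve n) 2 := by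
  have hodd : Odd n := Nat.odd_iff.mpr (by omega)
  obtain ⟨k, p, hp, hp2, hinj, hprod⟩ := exists_odd_prime_family_of_squarefree hsq hodd
  have hpodd : ∀ i, Odd (p i) := fun i => (hp i).odd_of_ne_two (hp2 i)
  have hz : ∀ i, addLegendreSym 2 (p i) = 0 := fun i =>
    addLegendreSym_two_eq_zero_of_mod_eight (hpodd i) (hpm (p i) (hp i) (hprod ▸ dvd_prod_of_mem p (mem_univ i)))
  have hsel' : Nat.card ((congruentNumberCurve (∏ i, p i)).selmerGroup 2) = 8 := by rw [hprod]; exact hsel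
  have hgen := odd_genusSum₁_of_selmerEight_of_legendreSym_two_eq_zero p hp hpodd hinj (by rw [hprod]; exact h7) hz hsel'
  rw [hprod] at hgen
  exact Rank1Residual.P2.rankOne_sha_bsdp_two_congruentNumberCurve_of_selmerEight_noGZK hTYZ hsq (Or.inr h7) hsel (Or.inl hgen)

/-! ## §4 The whole `s = 1` stratum for `n ≡ 7 (mod 8)`, and all odd `n`, by name on the two printed facts -/

/-- **EVERY SQUARE-FREE `n ≡ 7 (mod 8)` WITH `#Sel⁽²⁾(E_n/ℚ) = 8`**, granted the two printed facts of the mover theory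
(`tyz_cmPointRingClassFrobeniusData`, `thm11_parity_of_scriptL`): `ord_{s=1} L(E_n, s) = 1`, `rank E_n(ℚ) = 1`, `Ш(E_n/ℚ)[2^∞] = 0`, `BSD(E_n, 2)`.
Split: a prime factor `≡ ±3 (mod 8)` ⟹ the Galois mover (`rankOne_sha_bsdp_two_of_selmerEight_of_facts_seven`); none ⟹ `Σ₁(n)` odd (§3, with
`tyz_genusPointData ⟸ tyz_cmPointRingClassData ⟸ tyz_cmPointRingClassFrobeniusData`).
[cite: TianYuanZhang2017, Thm. 1.1, Thm. 1.2 and §3] [cite: Smith2016CongruentDensity, Thm. 2.2 row 7(a)] [cite: Miller2011LMS, Def. 1.1] -/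
theorem rankOne_sha_bsdp_two_of_selmerEight_of_facts_seven_all (hF : tyz_cmPointRingClassFrobeniusData) (h11 : thm11_parity_of_scriptL)
    {n : ℕ} (hsq : Squarefree n) (h7 : n % 8 = 7)
    (hsel : haveI := isElliptic_congruentNumberCurve hsq.ne_zero; Nat.card ((congruentNumberCurve n).selmerGroup 2) = 8) :
    haveI := isElliptic_congruentNumberCurve hsq.ne_zero
    (congruentNumberCurve n).analyticRank = 1 ∧ (congruentNumberCurve n).mordellWeilRank = 1 ∧
      AddCommGroup.primaryComponent (congruentNumberCurve n).sha 2 = ⊥ ∧ BSDp (congruentNumberCurve n) 2 := by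
  by_cases h35 : ∃ q : ℕ, q.Prime ∧ q ∣ n ∧ (q % 8 = 3 ∨ q % 8 = 5)
  · exact rankOne_sha_bsdp_two_of_selmerEight_of_facts_seven hF h11 hsq h7 h35 hsel
  · push Not at h35
    have hodd : Odd n := Nat.odd_iff.mpr (by omega)
    have hpm : ∀ q : ℕ, q.Prime → q ∣ n → q % 8 = 1 ∨ q % 8 = 7 := by
      intro q hq hqn
      have hq2 : q ≠ 2 := by
        rintro rfl
        exact (Nat.not_even_iff_odd.mpr hodd) (even_iff_two_dvd.mpr hqn)
      have hqodd : q % 2 = 1 := Nat.odd_iff.mp (hq.odd_of_ne_two hq2)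
      have h := h35 q hq hqn
      omega
    exact rankOne_sha_bsdp_two_of_selmerEight_of_tyz_seven_pm_one
      (tyz_genusPointData_of_cmPointRingClassData (tyz_cmPointRingClassData_of_frobeniusData hF)) hsq h7 hpm hsel

/-- **`OfFacts` shape for the planner (all of `n ≡ 7 (mod 8)`)**: the conjunction of the two printed facts implies, for every square-free `n ≡ 7 (mod 8)`
with `#Sel₂(E_n) = 8`, `ord = rank = 1`, `Ш[2^∞] = 0` and BSD(E_n, 2). [cite: TianYuanZhang2017, Thm. 1.1, Thm. 1.2 and §3] [cite: Miller2011LMS, Def. 1.1] -/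
theorem selmerEight_mod_eight_seven_bsdp_two_of_facts_all :
    (tyz_cmPointRingClassFrobeniusData ∧ thm11_parity_of_scriptL) →
      ∀ n : ℕ, (hsq : Squarefree n) → n % 8 = 7 →
        (haveI := isElliptic_congruentNumberCurve hsq.ne_zero; Nat.card ((congruentNumberCurve n).selmerGroup 2) = 8) →
        haveI := isElliptic_congruentNumberCurve hsq.ne_zero
        (congruentNumberCurve n).analyticRank = 1 ∧ (congruentNumberCurve n).mordellWeilRank = 1 ∧
          AddCommGroup.primaryComponent (congruentNumberCurve n).sha 2 = ⊥ ∧ BSDp (congruentNumberCurve n) 2 :=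
  fun h _ hsq h7 hsel => rankOne_sha_bsdp_two_of_selmerEight_of_facts_seven_all h.1 h.2 hsq h7 hsel

/-- **EVERY SQUARE-FREE ODD `n ≡ 5, 7 (mod 8)` WITH `#Sel⁽²⁾(E_n/ℚ) = 8`** (g7's `n ≡ 5` theorem p694796 and this file's `n ≡ 7` theorem): granted
`tyz_cmPointRingClassFrobeniusData` and `thm11_parity_of_scriptL`, `ord = rank = 1`, `Ш[2^∞] = 0`, `BSD(E_n, 2)` — the minimal-`2`-Selmer converse
with the `2`-part of BSD for the odd congruent-number twists of root number `−1`, conditional exactly on printed statements.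
[cite: TianYuanZhang2017, Thm. 1.1, Thm. 1.2 and §3] [cite: HeathBrown1994SelmerCongruentII, Appendix (Monsky)] [cite: Miller2011LMS, Def. 1.1] -/
theorem rankOne_sha_bsdp_two_of_selmerEight_of_facts_odd_all (hF : tyz_cmPointRingClassFrobeniusData) (h11 : thm11_parity_of_scriptL)
    {n : ℕ} (hsq : Squarefree n) (h57 : n % 8 = 5 ∨ n % 8 = 7)
    (hsel : haveI := isElliptic_congruentNumberCurve hsq.ne_zero; Nat.card ((congruentNumberCurve n).selmerGroup 2) = 8) :
    haveI := isElliptic_congruentNumberCurve hsq.ne_zero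
    (congruentNumberCurve n).analyticRank = 1 ∧ (congruentNumberCurve n).mordellWeilRank = 1 ∧
      AddCommGroup.primaryComponent (congruentNumberCurve n).sha 2 = ⊥ ∧ BSDp (congruentNumberCurve n) 2 := by
  rcases h57 with h5 | h7
  · exact rankOne_sha_bsdp_two_of_selmerEight_of_facts hF h11 hsq h5 hsel
  · exact rankOne_sha_bsdp_two_of_selmerEight_of_facts_seven_all hF h11 hsq h7 hsel

/-- **`BSD(W, 2)` for every globally minimal `W/ℚ` isogenous to a minimal-Selmer `E_n`, `n ≡ 5, 7 (mod 8)` square-free**, granted the two printed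
TYZ facts and conjuncts 1–3 of the route's bundle 𝔅_ram (GZK, entire `L`, Cassels). [cite: MilneADT2006, Thm. I.7.3] [cite: TianYuanZhang2017, Thm. 1.1 and §3]
[cite: Miller2011LMS, Def. 1.1] -/
theorem bsdp_two_of_isIsogenous_selmerEight_odd_all (hF : tyz_cmPointRingClassFrobeniusData) (h11 : thm11_parity_of_scriptL)
    (hGZK : rank_eq_analyticRank_of_analyticRank_le_one) (hL : hasEntireLFunction_rat) (hCassels : bsdRHS_eq_of_isIsogenous)
    {W : WeierstrassCurve ℚ} [W.IsElliptic] [W.IsGloballyMinimal]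
    {n : ℕ} (hsq : Squarefree n) (h57 : n % 8 = 5 ∨ n % 8 = 7)
    (hsel : haveI := isElliptic_congruentNumberCurve hsq.ne_zero; Nat.card ((congruentNumberCurve n).selmerGroup 2) = 8)
    (hiso : IsIsogenous W (congruentNumberCurve n)) : BSDp W 2 := by
  haveI := isElliptic_congruentNumberCurve hsq.ne_zero
  haveI := isGloballyMinimal_congruentNumberCurve hsq
  obtain ⟨hr1, -, -, h₀⟩ := rankOne_sha_bsdp_two_of_selmerEight_of_facts_odd_all hF h11 hsq h57 hsel
  exact Wuthrich2014.bsdp_of_isIsogenous hCassels hiso (hGZK (congruentNumberCurve n) hr1.le).2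
    ((congruentNumberCurve n).leadingLCoeff_ne_zero_holds (hL (congruentNumberCurve n))) h₀

end Summit.BirchSwinnertonDyer.PrintCf2.MoverAssembly

end
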